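import Mathlib
import HarnessLib
import HarnessLib.Audit
import Summits.AtomisticToContinuum.Statement
import Literature.MathematicalPhysics.KineticTheory.LangevinChainKernel
import Literature.MathematicalPhysics.KineticTheory.LangevinChainGibbs
import Literature.MathematicalPhysics.KineticTheory.LangevinChainNESS
import Summits.AtomisticToContinuum.FouriersLaw.Theorems.EmbeddedDrudeMourreNessUnique
import Summits.AtomisticToContinuum.FouriersLaw.Theorems.FourierGreenKuboFourierFiniteResponseOfUnique

/-!
Route: WeylLawForHeat

CLOSED (retired) 2026-08-15T13:47:36Z by operator:999:1257524 — reason: not-a-thesis: assembly does not conclude the sub-problem Statement — note: D-0027 §2.1 audit (human 2026-08-15: routes that do not decide the summit are removed): the assembly concludes `Literature.MathematicalPhysics.KineticTheory.HeatConduction.FouriersLaw`, not the sub-problem statement; a NEW conforming route may be opened from the same idea (generated `closes : … → _r. The file is kept as the record of this route; refuted decls are indexed as negative knowledge (`ledger negatives`).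

# Route WeylLawForHeat — Weyl law for heat — read κ = c_v·D_th off the N⁻² relaxation spectrum of
the equilibrium thermostatted chain

X_W (WEYL LAW FOR HEAT; realises idea card AtomisticToContinuum/FouriersLaw/weyl-law-for-heat). Work
at EQUILIBRIUM (both baths at T) with
the objects already in tree: P = pinnedChain ω₂ lam β γ (all > 0), μ_N = P.gibbsMeasure N T, the
CONSTRUCTED transition kernels
K_t = P.transitionKernel N T T t, the sine (k = 1, Dirichlet) energy mode E_N = Σ_i
sin(π(i+½)/N)·e_i (site energies e_i, bonds split
symmetrically), its Gibbs variance V_N and its autocorrelation c_N(t) = ∫ Ê_N · K_t Ê_N dμ_N. It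
suffices to show X_W = L ∧ U ∧ W ∧ H:
(L) HydrodynamicGap — N-uniform-prefactor correlation decay |⟨f̂, K_t ĝ⟩_μN| ≤ A e^(−ct/N²)‖f̂‖‖ĝ‖
for all f, g ∈ L²(μ_N) (anharmonicity must
SPEED UP the slowest relaxation from the harmonic N⁻³ to N⁻²); (U) SineModeDiffusive — c_N(t) ≥ (1 −
Ct/N²)V_N (the heat mode cannot relax
faster than diffusively = energy spreads at most diffusively, uniformly in N, t); (W)
WeylScalingDichotomy — on the diffusive clock t = N²s the
normalised autocorrelation c_N(N²s)/V_N converges, either to exp(−π²D_th s) for a constant D_th ≥ 0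
or to 0 for every s > 0; (H)
WeylConstantIsConductivity — whenever the limit is exp(−π²D_th s) with D_th > 0 and
Var_μN(H_N)/(NT²) → c_v, BLR's response coefficients
satisfy D_N → c_v·D_th. U kills the degenerate branch, L forces D_th ≥ c/π² > 0, so κ(T) :=
c_v(T)·D_th(T) ∈ (0,∞) and clause (ii) of
FouriersLawFor follows; clause (i) is the landed fact CuneoEckmannHairerReyBellet2018_pinnedChain +
NessUnique (shared item 0741).
Lean:
`Literature.MathematicalPhysics.KineticTheory.HeatConduction.CuneoEckmannHairerReyBellet2018_pinnedChain
→ NessUnique → FiniteResponseOfUnique → SpecificHeatLimit → SineModeBasics → HydrodynamicGap →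
SineModeDiffusive → WeylScalingDichotomy → WeylConstantIsConductivity →
Literature.MathematicalPhysics.KineticTheory.HeatConduction.FouriersLaw`

## Assembly
Verified glue (planner folder AssemblyCheck.lean: rc 0, sorries 0, axioms
propext/Classical.choice/Quot.sound; ~50 lines over two generic
real-analysis lemmas). Clause (i): fact (N ≥ 1) / OscillatorChain.isSteadyState_zero (N = 0) +
NessUnique. Clause (ii) at T > 0: take c_v from
SpecificHeatLimit and D_th with its branch from WeylScalingDichotomy; branch Z contradicts
SineModeDiffusive + SineModeBasics at s = 1/(2 max C 1)
(limit 0 versus c_N/V_N ≥ 1/2); in branch E, HydrodynamicGap instantiated at f = g = E_N (L² by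
SineModeBasics), t = N²s gives c_N(N²s)/V_N ≤
A e^(−cs), hence exp(−π²D_th s) ≤ A e^(−cs) for all s and D_th > 0; set κ(T) := c_v·D_th > 0 (κ := 1
for T ≤ 0); for a steady-state family pick
D_N from FiniteResponseOfUnique and conclude D_N → κ(T) by WeylConstantIsConductivity; finish with
fouriersLaw_of_steadyState_and_linearResponse.

Rationale: WHY THIS LINE. BLR's κ is read here off the RELAXATION SPECTRUM of the equilibrium N-site generator
L_N = A_H + γS on L²(μ_N): for a normal conductor the
bottom of −N²L_N must converge to the Dirichlet heat spectrum π²k²·κ/c_v (a Weyl law), whereas the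
solved harmonic chain shows an anomalously
DENSE slow spectrum λ_S ≍ N⁻³ (BeckerMenegaki2022 Thm 1, Menegaki2020 Prop 1.6) — so anharmonicity
must accelerate relaxation, a sharp,
falsifiable target replacing the impossible N-uniform gap (Villani2009 §9.2; barriers
BeckerMenegaki2022_gapClosing, equilibrium_rate_bound).
Imported areas: spectral theory of non-self-adjoint hypoelliptic generators — detailed balance with
momentum flip makes L_N self-adjoint for the
indefinite form [f,g] = ⟨Θf,g⟩ (generalised PT / Krein symmetry, HerauHitrikSjostrand2011 §3.1 Props
3.1–3.2: low eigenvalues REAL of positive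
type), compact-resolvent technology at fixed N (EckmannHairer2003, CuneoEckmannHairerReyBellet2018),
the N⁻² hydrodynamic gaps of reversible
conservative lattice gases (LuYau1993, Quastel1992) and the Pollicott–Ruelle dispersion relation s_k
= −Dk² of deterministic diffusive maps
(Gaspard1998) as the models; hydrodynamics/Landau–Placzek for the identification (Spohn1991,
KunduDharNarayan2009 open-chain Kubo formula
(N−1)T²D_N = ∫₀^∞⟨J(t)J(0)⟩_N). What no prior route does: FourierGreenKubo integrates the
infinite-volume current autocorrelation,
Fekete/Superadditive/Escape lines compare finite chains or read one boundary scalar; this line makes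
the two halves of Fourier's law the two
one-sided N⁻² bounds on ONE equilibrium mode (positivity = gap L, finiteness = diffusive bound U)
and the constant an eigenvalue asymptotic,
each checkable by equilibrium MD and small-N spectra. The assembly is verified glue
(AssemblyCheck.lean in the planner folder, rc 0).

RANKED CRUXES. #2 HydrodynamicGap (crux) — (card crux 1, W2/L) for all parameters > 0 and T > 0
there are A, c > 0 such that for every N ≥ 1, t ≥ 0 and f, g ∈ L²(μ_N): |∫ (f − μ_N f)·K_t(g − μ_N
g) dμ_N| ≤ A·e^(−ct/N²)·‖f − μ_N f‖_2·‖g − μ_N g‖_2 — an L²(Gibbs) spectral gap ≳ N⁻² with N-uniform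
prefactor for the constructed equilibrium semigroup: no observable relaxes slower than the heat mode
(excludes breathers, hidden even charges, insulating behaviour); false for the harmonic member (gap
≍ N⁻³). [difficulty: open-problem] (why it might fail: No L²(Gibbs) rate is printed for any
anharmonic chain even at fixed N (only weighted-L² compact resolvent); an N-uniform prefactor can
die on rare high-energy or near-integrable low-T configurations (c(T)→0), and an emergent even
quasi-conserved density would add a slower sector.) [BeckerMenegaki2022, Menegaki2020, Villani2009,
EckmannHairer2003, HairerMattingly2009, LuYau1993,
Literature.Barriers.AtomisticToContinuum.equilibrium_rate_bound]
#3 SineModeDiffusive (crux) — (card crux 2, W1-upper/U) for all parameters > 0 and T > 0 there is C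
such that for every N ≥ 2 and t ≥ 0: c_N(t) ≥ (1 − C·t/N²)·V_N, i.e. Var(E_N(t) − E_N(0)) ≤
2C·t·V_N/N²: the sine energy mode decorrelates at most linearly at slope C/N² — equivalently
(continuity equation L e_i = j_(i−1) − j_i + bath terms, mode gradient π/N) the weighted
time-integrated current has diffusively bounded variance uniformly in N and t, the finiteness half
of Fourier's law (open-chain Green–Kubo boundedness); it forces any exponential decay estimate with
prefactor A′ to have rate ≤ 2C ln(2A′)/N². [difficulty: XL] (why it might fail: It is an N,t-uniform
linear bound on the energy mean-square displacement: false for the harmonic member (ballistic, 1 −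
c_N/V_N ≈ π²v²t²/N²) and under any odd conserved charge; needs C(T) ≳ v·ℓ_mfp(T), unbounded as T→0;
super-diffusive tails would break it.) [KunduDharNarayan2009, BonettoLebowitzReyBellet2000,
LepriLiviPoliti2003, Literature.Barriers.AtomisticToContinuum.rate_le_of_slowObservable,
Literature.Barriers.AtomisticToContinuum.HarmonicChainBallisticFlux]
#4 WeylScalingDichotomy (crux) — (card crux 3, W1 with constant, in dichotomy form so that both
one-sided cruxes stay load-bearing) for all parameters > 0 and T > 0 there is D_th ≥ 0 such that
EITHER for every s ≥ 0, c_N(N²s)/V_N → exp(−π²·D_th·s) as N → ∞ (a single real, non-oscillatory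
hydrodynamic mode carries asymptotically ALL of the sine-mode variance: Landau–Placzek completeness
+ Weyl constant π²D_th, Robin/contact corrections vanish as N → ∞), OR for every s > 0, c_N(N²s)/V_N
→ 0 (relaxation faster than diffusive — the ballistic-type alternative, excluded by
SineModeDiffusive). HydrodynamicGap then gives D_th ≥ c/π² > 0. [difficulty: open-problem] (why it
might fail: The diffusive-clock limit may not exist (1-D long-time-tail corrections, low-T size
resonances make N²λ₁ oscillate), or the sine mode keeps O(1) weight outside the k=1 sector (a second
even slow density), giving a two-exponential limit outside both branches.) [LampinEtAl2013,
Gaspard1998, Spohn2014, HerauHitrikSjostrand2011, Spohn1991]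
#5 WeylConstantIsConductivity (crux) — (card: HydrodynamicConsistency / Einstein relation) for all
parameters > 0, under weak-NESS uniqueness, for every steady-state family μ, every T > 0 and every
sequence D of finite-N response coefficients (D N = lim_(δ→0,δ≠0) totalCurrent(μ N (T+δ/2)
(T−δ/2))/δ), and all reals D_th > 0, c_v: IF c_N(N²s)/V_N → exp(−π²D_th s) for every s ≥ 0 AND
Var_μN(H_N)/(N·T²) → c_v, THEN D N → c_v·D_th. Content: open-chain Kubo formula (N−1)T²D_N =
∫₀^∞⟨J(t)J(0)⟩_N (KunduDharNarayan2009) + continuity equation + control of current correlations up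
to diffusive times, i.e. the Einstein relation κ = c_v·D_th for the boundary-driven chain. [deps:
WeylScalingDichotomy, SpecificHeatLimit] [difficulty: open-problem] (why it might fail: κ = c_v·D_th
for the boundary-driven chain is a hydrodynamic-limit statement of the 0742 class: it needs the
open-chain Kubo formula plus N-uniform control of current correlations up to times ≍ N²;
contact-dominated corners could decouple D_N from the bulk mode at accessible N.)
[KunduDharNarayan2009, BonettoLebowitzReyBellet2000, Dhar2008, ReyBellet2003, Spohn1991,
KipnisLandim1999]
#9 SineModeBasics (support) — for all parameters > 0, T > 0 and N ≥ 1 the sine energy mode E_N is in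
L²(μ_N) and has positive Gibbs variance V_N > 0 (polynomial moments under the Gibbs measure via the
proved e^(ϑH)-integrability; non-constancy of E_N). De-junks the Bochner integrals in U, W, H and
feeds the L-instance in the assembly. [difficulty: provable-now] [CuneoEckmannHairerReyBellet2018,
BonettoLebowitzReyBellet2000]
#9 SpecificHeatLimit (support) — for all parameters > 0 and T > 0 the specific heat per site exists:
Var_μN(H_N)/(N T²) → c_v(T) with c_v > 0 (kinetic part alone gives ≥ 1/2; convergence by the 1-D
transfer operator e^(−U/2T)e^(−V(q′−q)/T)e^(−U/2T), Hilbert–Schmidt with simple top eigenvalue,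
analytic free energy). Standard 1-D equilibrium statistical mechanics; known, not in tree.
[difficulty: L] [Spohn1991, arXiv:2604.14056, BonettoLebowitzReyBellet2000]
#9 GibbsKernelInvariant (support) — for all parameters > 0, T > 0, N ≥ 1 and t ≥ 0 the Gibbs measure
is INVARIANT for the constructed transition kernels at equal bath temperatures: (gibbsMeasure N
T).bind (transitionKernel N T T t) = gibbsMeasure N T. In tree only weak stationarity
(pinnedChain_isSteadyState_gibbsMeasure) is proved; invariance = Echeverría's theorem (weak
stationary for a core ⇒ invariant, EthierKurtz1986 Thm 4.9.17) or Itô on the pathwise solution. Same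
content as clause (a) of BoundaryKernelBasics (route EscapeDeficit, stmt-2949); infrastructure for
contraction of K_t on L²(μ_N) and stationarity of correlations used by every crux. [difficulty: M]
[EthierKurtz1986, CuneoEckmannHairerReyBellet2018]
#9 KreinSymmetry (support) — (card support 4, the structural lever, theorem-grade) DETAILED BALANCE
WITH MOMENTUM FLIP for every chain with C¹ potentials, T > 0 and integrable Gibbs density: for f, g
∈ C²_c, ∫ f·(L g) dμ_T = ∫ g·((L(f∘Θ))∘Θ) dμ_T with L = P.generator N T T and Θ = momentumReversal —
i.e. L† = ΘLΘ in L²(μ_T) (Liouville part antisymmetric and Θ-odd, Ornstein–Uhlenbeck bath parts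
symmetric and Θ-even), so L is formally self-adjoint for the indefinite (Krein) form [f,g] := ⟨Θf,g⟩
(HerauHitrikSjostrand2011 §3.1 (kfp.5), Props 3.1–3.2). Provable now from the integration-by-parts
lemmas of LangevinChainGibbs (integral_liouville/bath_mul_gibbsDensity). Consequences used
informally by W/H: hydrodynamic eigenvalues are real of positive type, min–max on definite
subspaces. [difficulty: provable-now] [HerauHitrikSjostrand2011, KunduDharNarayan2009,
BonettoLebowitzReyBellet2000]
#9 NessUnique (support) — (shared item stmt-AtomisticToContinuum-0741) uniqueness of the weak steady
state (IsSteadyState class) of pinnedChain for all N, T_L, T_R > 0; with the landed fact it gives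
clause (i) and makes D_N canonical. [difficulty: L] [CuneoEckmannHairerReyBellet2018, Carmona2007]
#9 FiniteResponseOfUnique (support) — (shared item stmt-AtomisticToContinuum-0717) under weak-NESS
uniqueness the finite-N linear-response limits D_N(T) exist for every steady-state family, T > 0 and
N. [difficulty: L] [ReyBellet2003, HairerMajda2009]

TWO-LAYER PLAN. Foreseen glued splits (k ≤ 3, depth 1), none filed now: HydrodynamicGap ⇐ FixedNGap
(compact resolvent + L²(μ_N) gap at each N, EckmannHairer2003
technology on L²(Gibbs)) → HydroWeightedPoincare (N²-weighted hypocoercive functional with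
hydrodynamic (k-dependent) weights / Krein min–max on the
positive-type sector) → HydrodynamicGap. SineModeDiffusive ⇐ CurrentNoiseBound (∫₀^t⟨J_ψ,K_sJ_ψ⟩ds ≤
C·N uniformly) → DynkinForModes (Dynkin +
stationarity for polynomial observables: Var(E_N(t)−E_N(0)) = 2(V_N − c_N(t))) → SineModeDiffusive.
WeylConstantIsConductivity ⇐ OpenChainKubo
(KDN identity (N−1)T²D_N = ∫⟨J,K_tJ⟩, shared with the escape/contact cards) → EinsteinRelation
(current correlations from the energy kernel via the
continuity equation up to diffusive times) → WeylConstantIsConductivity; the Feshbach–Schur engine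
of card feshbach-energy-profile-memory
(MemoryRegularity → DiscreteEllipticLimit) is the natural alternative decomposition of W ∧ H and
would be a sibling route sharing these decls.

KILL CRITERIA. A proof that some observable of the anharmonic chain relaxes slower than N⁻² in
L²(μ_N) (¬HydrodynamicGap: e.g. a positive-temperature breather
family or an even quasi-conserved density) closes the route `refuted:HydrodynamicGap` and hands the
witness to the negatives index (it would also
bear on every hydrodynamic line). ¬SineModeDiffusive (super-diffusive or ballistic energy spreading
at some T) refutes finiteness of κ itself —
file ¬FouriersLaw material. WeylScalingDichotomy refuted by a two-mode/stretched limit ⇒ pivot: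
restate W for the spectral projection onto the
slowest real eigenvalue (Krein positive-type sector) instead of the sine mode. If route
FourierGreenKubo closes 0742 + 0703, H becomes a
corollary (κ_GK = c_v D_th by Landau–Placzek) and this route is superseded for the conjunct but
keeps L, U, W as the relaxation-spectrum theorems.

NOT DECOMPOSED YET. The engine of HydrodynamicGap (weighted hypocoercivity vs Krein min–max vs
coupling to the harmonic N⁻³ computation by FGR widths ∝ (lam·T)²);
compact resolvent / discreteness of σ(L_N) on L²(μ_N) at fixed N and the Krein perturbation theory
of the Ornstein–Uhlenbeck spectrum in (lam, β)
(card support 4 — a definition of the L²-generator is not in tree, so no typed item yet); higher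
modes k ≥ 2 and the Robin/contact correction
N → N + ℓ_L + ℓ_R; T-dependence and continuity of κ; the KDN identity as a separate typed item (left
to the escape/contact routes that already
want it); GibbsKernelInvariant's FP-uniqueness lemma (shared burden with 0741).

CHEAPEST FALSIFIER. (i) Small-N spectra, no dynamics: Hermite–polynomial Galerkin matrix of L_N on
L²(μ_N) for N = 2, 3, 4 at (ω₂,lam,β,γ,T) = (1,1,1,1,1): is the
slowest non-zero eigenvalue REAL with a Θ-even (energy-like) eigenvector of positive Krein type, and
does N²·Re λ₁ move towards a plateau while
the lam = β = 0 control follows N⁻³? A complex slowest pair or a Θ-odd slowest mode kills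
WeylScalingDichotomy's branch E as stated. (ii)
Equilibrium MD of the open chain, N ∈ {16,…,256}: fit c_N(t)/V_N on the clock t/N²; the line dies if
the curves do not collapse onto one
exponential, if 1 − c_N(t)/V_N grows faster than linearly in t/N² (¬U), or if the collapse constant
disagrees with π²κ_NEMD/c_v. Neither could
be run here (kit compute is not available to plancard units); protocol recorded for the refuter.

NUMBERS. Harmonic member: λ_S ≍ N⁻³ (BeckerMenegaki2022 Thm 1 (1)); any chain at equilibrium: an
L²(μ_N) decay estimate with prefactor C has rate ≤
4√2·γ·ln(2C)/√N (equilibrium_rate_bound, proved) — consistent with c/N²; trace bound λ_S ≤ γ/N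
(BeckerMenegaki2022_gapClosing, proved).
Unconditional slow-observable bound for the sine mode: rate ≤ 2‖LÊ_N‖·ln(2C)/‖Ê_N‖ = O(ln C/N)
(rate_le_of_slowObservable with ‖LÊ_N‖ = O(N^(−1/2)),
‖Ê_N‖ ≍ N^(1/2)). Expected: N²λ₁ → π²κ/c_v with c_v ≥ 1/2 (kinetic) and ⟨e⟩/T ∈ [1, 3/2] (virial);
Robin correction N → N + 2ℓ, ℓ = κ × contact
resistance (LepriLiviPoliti2003 §3.4). Items at open: 11 (4 cruxes, 6 support, 1 assembly).

DEFINITION REQUESTS. None needed: every statement is typed over FouriersLaw.lean +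
LangevinChainKernel (transitionKernel) + LangevinChainGibbs (gibbsMeasure,
momentumReversal); the sine mode, its variance and autocorrelation are written inline with `let`. A
later convenience definition
`OscillatorChain.siteEnergy` / `energyMode` in Literature/MathematicalPhysics/KineticTheory would
shorten the decls; the L²(μ_N)-generator as an
unbounded operator (for compact-resolvent / Krein items) is the one notion Lean lacks and is
deliberately not requested at open.

Novelty: Searches (2026-08-15, this planner, on top of the card's and the novelty audit's): `lit search
--source crossref` for "Herau Hitrik Sjostrand
tunnel effect symmetries Kramers-Fokker-Planck" (→ doi:10.1017/s1474748011000028, read §3.1: P* =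
U_κ⁻¹PU_κ, Props 3.1–3.2), "Lu Yau spectral
gap Kawasaki" (doi:10.1007/bf02098489), "Lampin approach-to-equilibrium molecular dynamics"
(doi:10.1063/1.4815945 + Zaoui et al.
doi:10.1103/physrevb.94.054304 length dependence), "Becker Menegaki optimal spectral gap" (→ also
BeckerMenegakiYu2025
doi:10.1016/j.matpur.2025.103796: long-range HARMONIC chains, still no anharmonic N-dependence),
"spectral gap boundary driven symmetric
exclusion N^-2" (Franco–Gonçalves–Landim Robin SSEP, hydrodynamics not spectra), "hypocoercivity
chain of oscillators N dependence" (nothing);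
`lit galaxy search --star all` for "spectral gap of the chain of oscillators" (0 hits) and "approach
to equilibrium molecular dynamics" (1
engineering monograph); `lit frontier AtomisticToContinuum --since 2021` (30 rows: arXiv:2310.13338
heat equation via chaotic bulk force,
arXiv:2604.14056 specific heat of driven chains — relevant to SpecificHeatLimit only); `lit read
arXiv:0809.4543` p.3 (KDN central result G =
(k_BT²)⁻¹∫⟨j̄(t)j̄(0)⟩, j̄ = J/(N−1)); openalex/arXiv APIs rate-limited this session (recorded, not
worked around); the 12 FouriersLaw routes now
open (none uses relaxation rates; EscapeDeficit reads a boundary scalar's t^(−1/2) tail, DrudeMourre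
the infinite closed c  [refs: 10.1017/s1474748011000028, 10.1007/bf02098489, 10.1063/1.4815945, 10.1103/physrevb.94.054304, 10.1016/j.matpur.2025.103796:, 2310.13338, 2604.14056, 0809.4543, doi:10.1017/s1474748011000028, doi:10.1007/bf02098489, doi:10.1063/1.4815945, doi:10.1103/physrevb.94.054304, doi:10.1016/j.matpur.2025.103796, BeckerMenegakiYu2025, BeckerMenegaki2022, Menegaki2020, HerauHitrikSjostrand2011, LuYau1993, Qua]

Barriers (technique_class: weyl-law relaxation-spectrum krein-sign hydro-gap): - technique_class: weyl-law relaxation-spectrum krein-sign hydro-gap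
- Literature.Barriers.AtomisticToContinuum.BeckerMenegaki2022_gapClosing: EMBRACED — no N-uniform
rate is claimed; HydrodynamicGap asks for rate c/N², outside the barrier's class, and the proved
harmonic law N⁻³ is the contrast the route must beat (L is false at lam = β = 0, as it must be).
- Literature.Barriers.AtomisticToContinuum.equilibrium_rate_bound: consistent by two orders — with
prefactor A the barrier allows rates up to 4√2γ ln(2A)/√N ≫ c/N²; U is the diffusive sharpening of
the same slow-observable mechanism (rate_le_of_slowObservable) for the sine mode.
- Literature.Barriers.AtomisticToContinuum.HairerMattingly2009_threeOscillators: the named failure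
mode of HydrodynamicGap; pinnedChain has interaction degree = pinning degree (C5), where compact
resolvent is expected at fixed N, but N-uniform prefactors over high-energy configurations are
exactly what L bets on — it does not evade, it decides.
- Literature.Barriers.AtomisticToContinuum.HasBoundedResponse: not extrapolated from fixed N — every
crux is asymptotic in N; bounded response follows from U ∧ W ∧ H, never assumed.
- Literature.Barriers.AtomisticToContinuum.HarmonicChainBallisticFlux: evaded by design — at lam = β
= 0 both L (gap N⁻³) and U (ballistic spreading) FAIL while W holds in branch Z; the route cannot
prove Fourier's law for the harmonic chain.
- Literature.Barriers.AtomisticToContinuum.LowTemperatureWeakAnharmonicity: conceded —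

History (route lifecycle, newest last):
- 2026-08-15T13:47:36Z · CLOSED retired — not-a-thesis: assembly does not conclude the sub-problem Statement (operator:999:1257524)

sub-problem: FouriersLaw · status: closed(retired) · opened planner-plancard-AtomisticToContinuum-Fourier-c4518749-0 2026-08-15T11:28:22Z · rev 0 · ledger route-AtomisticToContinuum-WeylLawForHeat
GENERATED by the gate from the ledger (D-0016/17). Provers cite these decls: `theorem foo : Summit.AtomisticToContinuum.FouriersLaw.Theses.WeylLawForHeat.<Decl> := …` in Summits/AtomisticToContinuum/FouriersLaw/Theorems/<Name>.lean.
-/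

namespace Summit.AtomisticToContinuum.FouriersLaw.Theses.WeylLawForHeat

open scoped BigOperators Topology Manifold Classical MeasureTheory ProbabilityTheory Matrix InnerProductSpace ComplexConjugate ContinuousMap
open Filter Set Function TopologicalSpace MeasureTheory

attribute [summit_statement] _root_.FouriersLaw

/-- item stmt-AtomisticToContinuum-4133 · crux · rank 2 · closed · moot by None · by planner
why it might fail: No L²(Gibbs) rate is printed for any anharmonic chain even at fixed N (only weighted-L² compact resolvent); an N-uniform prefactor can die on rare high-energy or near-integrable low-T configurations (c(T)→0), and an emergent even quasi-conserved density would add a slower sector.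
sources: BeckerMenegaki2022, Menegaki2020, Villani2009, EckmannHairer2003, HairerMattingly2009, LuYau1993
[crux] (card crux 1, W2/L) for all parameters > 0 and T > 0 there are A, c > 0 such that for every N
≥ 1, t ≥ 0 and f, g ∈ L²(μ_N): |∫ (f − μ_N f)·K_t(g − μ_N g) dμ_N| ≤ A·e^(−ct/N²)·‖f − μ_N f‖_2·‖g −
μ_N g‖_2 — an L²(Gibbs) spectral gap ≳ N⁻² with N-uniform prefactor for the constructed equilibrium
semigroup: no observable relaxes slower than the heat mode (excludes breathers, hidden even charges,
insulating behaviour); false for the harmonic member (gap ≍ N⁻³). [difficulty: open-problem] -/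
@[route_item "route-AtomisticToContinuum-WeylLawForHeat"]
def HydrodynamicGap : Prop :=
  ∀ ω₂ lam β γ : ℝ, 0 < ω₂ → 0 < lam → 0 < β → 0 < γ → ∀ T : ℝ, 0 < T → (let P := Literature.MathematicalPhysics.KineticTheory.HeatConduction.pinnedChain ω₂ lam β γ; ∃ A c : ℝ, 0 < A ∧ 0 < c ∧ ∀ N : ℕ, 1 ≤ N → ∀ t : ℝ, 0 ≤ t → ∀ f g : Literature.MathematicalPhysics.KineticTheory.HeatConduction.PhaseSpace N → ℝ, MeasureTheory.MemLp f 2 (P.gibbsMeasure N T) → MeasureTheory.MemLp g 2 (P.gibbsMeasure N T) → |∫ x, (f x - ∫ y, f y ∂(P.gibbsMeasure N T)) * (∫ y, (g y - ∫ z, g z ∂(P.gibbsMeasure N T)) ∂(P.transitionKernel N T T t.toNNReal x)) ∂(P.gibbsMeasure N T)| ≤ A * Real.exp (-(c * t / (N : ℝ) ^ 2)) * Real.sqrt (∫ x, (f x - ∫ y, f y ∂(P.gibbsMeasure N T)) ^ 2 ∂(P.gibbsMeasure N T)) * Real.sqrt (∫ x, (g x - ∫ y, g y ∂(P.gibbsMeasure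 N T)) ^ 2 ∂(P.gibbsMeasure N T)))

/-- item stmt-AtomisticToContinuum-4134 · crux · rank 3 · closed · moot by None · by planner
why it might fail: It is an N,t-uniform linear bound on the energy mean-square displacement: false for the harmonic member (ballistic, 1 − c_N/V_N ≈ π²v²t²/N²) and under any odd conserved charge; needs C(T) ≳ v·ℓ_mfp(T), unbounded as T→0; super-diffusive tails would break it.
sources: KunduDharNarayan2009, BonettoLebowitzReyBellet2000, LepriLiviPoliti2003, Literature.Barriers.AtomisticToContinuum.rate_le_of_slowObservable, Literature.Barriers.AtomisticToContinuum.HarmonicChainBallisticFlux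
[crux] (card crux 2, W1-upper/U) for all parameters > 0 and T > 0 there is C such that for every N ≥
2 and t ≥ 0: c_N(t) ≥ (1 − C·t/N²)·V_N, i.e. Var(E_N(t) − E_N(0)) ≤ 2C·t·V_N/N²: the sine energy
mode decorrelates at most linearly at slope C/N² — equivalently (continuity equation L e_i = j_(i−1)
− j_i + bath terms, mode gradient π/N) the weighted time-integrated current has diffusively bounded
variance uniformly in N and t, the finiteness half of Fourier's law (open-chain Green–Kubo
boundedness); it forces any exponential decay estimate with prefactor A′ to have rate ≤ 2C
ln(2A′)/N². [difficulty: XL] -/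
@[route_item "route-AtomisticToContinuum-WeylLawForHeat"]
def SineModeDiffusive : Prop :=
  ∀ ω₂ lam β γ : ℝ, 0 < ω₂ → 0 < lam → 0 < β → 0 < γ → ∀ T : ℝ, 0 < T → (let P := Literature.MathematicalPhysics.KineticTheory.HeatConduction.pinnedChain ω₂ lam β γ; let e : (N : ℕ) → Literature.MathematicalPhysics.KineticTheory.HeatConduction.PhaseSpace N → ℝ := fun N x => (∑ i : Fin N, Real.sin (Real.pi * ((i : ℝ) + 1 / 2) / N) * (x.2 i ^ 2 / 2 + P.U (x.1 i))) + ∑ i : Fin N, ∑ j : Fin N, (if j.val = i.val + 1 then (Real.sin (Real.pi * ((i : ℝ) + 1 / 2) / N) + Real.sin (Real.pi * ((j : ℝ) + 1 / 2) / N)) / 2 * P.V (x.1 j - x.1 i) else 0); let V : ℕ → ℝ := fun N => ∫ x, (e N x - ∫ y, e N y ∂(P.gibbsMeasure N T)) ^ 2 ∂(P.gibbsMeasure N T); let c : ℕ → ℝ → ℝ := fun N t => ∫ x, (e N x - ∫ y, e N y ∂(P.gibbsMeasure N T)) * (∫ y, (e N y - ∫ z, e N z ∂(P.gibbsMeasure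 N T)) ∂(P.transitionKernel N T T t.toNNReal x)) ∂(P.gibbsMeasure N T); ∃ C : ℝ, ∀ N : ℕ, 2 ≤ N → ∀ t : ℝ, 0 ≤ t → (1 - C * t / (N : ℝ) ^ 2) * V N ≤ c N t)

/-- item stmt-AtomisticToContinuum-4135 · crux · rank 4 · closed · moot by None · by planner
why it might fail: The diffusive-clock limit may not exist (1-D long-time-tail corrections, low-T size resonances make N²λ₁ oscillate), or the sine mode keeps O(1) weight outside the k=1 sector (a second even slow density), giving a two-exponential limit outside both branches.
sources: LampinEtAl2013, Gaspard1998, Spohn2014, HerauHitrikSjostrand2011, Spohn1991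
[crux] (card crux 3, W1 with constant, in dichotomy form so that both one-sided cruxes stay
load-bearing) for all parameters > 0 and T > 0 there is D_th ≥ 0 such that EITHER for every s ≥ 0,
c_N(N²s)/V_N → exp(−π²·D_th·s) as N → ∞ (a single real, non-oscillatory hydrodynamic mode carries
asymptotically ALL of the sine-mode variance: Landau–Placzek completeness + Weyl constant π²D_th,
Robin/contact corrections vanish as N → ∞), OR for every s > 0, c_N(N²s)/V_N → 0 (relaxation faster
than diffusive — the ballistic-type alternative, excluded by SineModeDiffusive). HydrodynamicGap
then gives D_th ≥ c/π² > 0. [difficulty: open-problem] -/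
@[route_item "route-AtomisticToContinuum-WeylLawForHeat"]
def WeylScalingDichotomy : Prop :=
  ∀ ω₂ lam β γ : ℝ, 0 < ω₂ → 0 < lam → 0 < β → 0 < γ → ∀ T : ℝ, 0 < T → (let P := Literature.MathematicalPhysics.KineticTheory.HeatConduction.pinnedChain ω₂ lam β γ; let e : (N : ℕ) → Literature.MathematicalPhysics.KineticTheory.HeatConduction.PhaseSpace N → ℝ := fun N x => (∑ i : Fin N, Real.sin (Real.pi * ((i : ℝ) + 1 / 2) / N) * (x.2 i ^ 2 / 2 + P.U (x.1 i))) + ∑ i : Fin N, ∑ j : Fin N, (if j.val = i.val + 1 then (Real.sin (Real.pi * ((i : ℝ) + 1 / 2) / N) + Real.sin (Real.pi * ((j : ℝ) + 1 / 2) / N)) / 2 * P.V (x.1 j - x.1 i) else 0); let V : ℕ → ℝ := fun N => ∫ x, (e N x - ∫ y, e N y ∂(P.gibbsMeasure N T)) ^ 2 ∂(P.gibbsMeasure N T); let c : ℕ → ℝ → ℝ := fun N t => ∫ x, (e N x - ∫ y, e N y ∂(P.gibbsMeasure N T)) * (∫ y, (e N y - ∫ z, e N z ∂(P.gibbsMeasure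 N T)) ∂(P.transitionKernel N T T t.toNNReal x)) ∂(P.gibbsMeasure N T); ∃ Dth : ℝ, 0 ≤ Dth ∧ ((∀ s : ℝ, 0 ≤ s → Filter.Tendsto (fun N : ℕ => c N ((N : ℝ) ^ 2 * s) / V N) Filter.atTop (nhds (Real.exp (-(Real.pi ^ 2 * Dth * s))))) ∨ (∀ s : ℝ, 0 < s → Filter.Tendsto (fun N : ℕ => c N ((N : ℝ) ^ 2 * s) / V N) Filter.atTop (nhds 0))))

/-- item stmt-AtomisticToContinuum-4136 · crux · rank 5 · closed · moot by None · by planner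
why it might fail: κ = c_v·D_th for the boundary-driven chain is a hydrodynamic-limit statement of the 0742 class: it needs the open-chain Kubo formula plus N-uniform control of current correlations up to times ≍ N²; contact-dominated corners could decouple D_N from the bulk mode at accessible N.
sources: KunduDharNarayan2009, BonettoLebowitzReyBellet2000, Dhar2008, ReyBellet2003, Spohn1991, KipnisLandim1999
[crux] (card: HydrodynamicConsistency / Einstein relation) for all parameters > 0, under weak-NESS
uniqueness, for every steady-state family μ, every T > 0 and every sequence D of finite-N response
coefficients (D N = lim_(δ→0,δ≠0) totalCurrent(μ N (T+δ/2) (T−δ/2))/δ), and all reals D_th > 0, c_v: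
IF c_N(N²s)/V_N → exp(−π²D_th s) for every s ≥ 0 AND Var_μN(H_N)/(N·T²) → c_v, THEN D N → c_v·D_th.
Content: open-chain Kubo formula (N−1)T²D_N = ∫₀^∞⟨J(t)J(0)⟩_N (KunduDharNarayan2009) + continuity
equation + control of current correlations up to diffusive times, i.e. the Einstein relation κ =
c_v·D_th for the boundary-driven chain. [deps: WeylScalingDichotomy, SpecificHeatLimit] [difficulty:
open-problem] -/
@[route_item "route-AtomisticToContinuum-WeylLawForHeat"]
def WeylConstantIsConductivity : Prop :=
  ∀ ω₂ lam β γ : ℝ, 0 < ω₂ → 0 < lam → 0 < β → 0 < γ → (∀ (N : ℕ) (T_L T_R : ℝ), 0 < T_L → 0 < T_R → ∀ μ ν : MeasureTheory.Measure (Literature.MathematicalPhysics.KineticTheory.HeatConduction.PhaseSpace N), (Literature.MathematicalPhysics.KineticTheory.HeatConduction.pinnedChain ω₂ lam β γ).IsSteadyState N T_L T_R μ → (Literature.MathematicalPhysics.KineticTheory.HeatConduction.pinnedChain ω₂ lam β γ).IsSteadyState N T_L T_R ν → μ = ν) → ∀ μ : (N : ℕ) → ℝ → ℝ → MeasureTheory.Measure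 (Literature.MathematicalPhysics.KineticTheory.HeatConduction.PhaseSpace N), (∀ (N : ℕ) (T_L T_R : ℝ), 0 < T_L → 0 < T_R → (Literature.MathematicalPhysics.KineticTheory.HeatConduction.pinnedChain ω₂ lam β γ).IsSteadyState N T_L T_R (μ N T_L T_R)) → ∀ T : ℝ, 0 < T → ∀ D : ℕ → ℝ, (∀ N : ℕ, Filter.Tendsto (fun δ : ℝ => (Literature.MathematicalPhysics.KineticTheory.HeatConduction.pinnedChain ω₂ lam β γ).totalCurrent (μ N (T + δ / 2) (T - δ / 2)) / δ) (nhdsWithin 0 {(0 : ℝ)}ᶜ) (nhds (D N))) → (let P := Literature.MathematicalPhysics.KineticTheory.HeatConduction.pinnedChain ω₂ lam β γ; let e : (N : ℕ) → Literature.MathematicalPhysics.KineticTheory.HeatConduction.PhaseSpace N → ℝ := fun N x => (∑ i : Fin N, Real.sin (Real.pi * ((i : ℝ) + 1 / 2) / N) * (x.2 i ^ 2 / 2 + P.U (x.1 i))) + ∑ i : Fin N, ∑ j : Fin N, (if j.val = i.val + 1 then (Real.sin (Real.pi * ((i : ℝ) + 1 / 2) / N) + Real.sin (Real.pi * ((j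 : ℝ) + 1 / 2) / N)) / 2 * P.V (x.1 j - x.1 i) else 0); let V : ℕ → ℝ := fun N => ∫ x, (e N x - ∫ y, e N y ∂(P.gibbsMeasure N T)) ^ 2 ∂(P.gibbsMeasure N T); let c : ℕ → ℝ → ℝ := fun N t => ∫ x, (e N x - ∫ y, e N y ∂(P.gibbsMeasure N T)) * (∫ y, (e N y - ∫ z, e N z ∂(P.gibbsMeasure N T)) ∂(P.transitionKernel N T T t.toNNReal x)) ∂(P.gibbsMeasure N T); ∀ Dth cv : ℝ, 0 < Dth → (∀ s : ℝ, 0 ≤ s → Filter.Tendsto (fun N : ℕ => c N ((N : ℝ) ^ 2 * s) / V N) Filter.atTop (nhds (Real.exp (-(Real.pi ^ 2 * Dth * s))))) → Filter.Tendsto (fun N : ℕ => (∫ x, (P.hamiltonian N x - ∫ y, P.hamiltonian N y ∂(P.gibbsMeasure N T)) ^ 2 ∂(P.gibbsMeasure N T)) / ((N : ℝ) * T ^ 2)) Filter.atTop (nhds cv) → Filter.Tendsto D Filter.atTop (nhds (cv * Dth)))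

/-- item stmt-AtomisticToContinuum-0717 · support · rank 9 · closed · proved by Summit.AtomisticToContinuum.FouriersLaw.Theorems.FourierGreenKubo.finiteResponseOfUnique_holds (prover) · by planner
sources: ReyBellet2003, HairerMajda2009
CONDITIONAL FORM OF 0705 (supersedes it as the prover target; refuters pool-5/g3-0: 0705 stand-alone
quantifies over EVERY steady-state family and is false-prone if weak steady states were non-unique):
assuming UNIQUENESS of weak steady states (IsSteadyState class) for pinnedChain at all N, T_L, T_R >
0, the finite-N linear-response limit D_N(T) = lim_{δ→0, δ≠0} totalCurrent(μ_{N,T+δ/2,T−δ/2})/δ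
exists for every T > 0 and N. Content: differentiability at equilibrium of NESS expectations of the
polynomial currents in the bath temperatures (ReyBellet2003 arXiv:math-ph/0303021 Rem 4.4 (51)–(56)
finite-volume Green–Kubo; HairerMajda2009 arXiv:0909.4313 Thm 2.3 framework — their SDE Thm 4.4
Assumption 5 fails here, so verify Assumptions 1–3 via CEHR2018 (2.5)/Carmona2007 Thm 1.1(iv)
weighted spectral gap). N = 0, 1: totalCurrent ≡ 0, D = 0. Together with 0706 gives 0705. -/
@[route_item "route-AtomisticToContinuum-WeylLawForHeat"]
def FiniteResponseOfUnique : Prop :=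
  ∀ ω₂ lam β γ : ℝ, 0 < ω₂ → 0 < lam → 0 < β → 0 < γ → (∀ (N : ℕ) (T_L T_R : ℝ), 0 < T_L → 0 < T_R → ∀ μ ν : MeasureTheory.Measure (Literature.MathematicalPhysics.KineticTheory.HeatConduction.PhaseSpace N), (Literature.MathematicalPhysics.KineticTheory.HeatConduction.pinnedChain ω₂ lam β γ).IsSteadyState N T_L T_R μ → (Literature.MathematicalPhysics.KineticTheory.HeatConduction.pinnedChain ω₂ lam β γ).IsSteadyState N T_L T_R ν → μ = ν) → ∀ μ : (N : ℕ) → ℝ → ℝ → MeasureTheory.Measure (Literature.MathematicalPhysics.KineticTheory.HeatConduction.PhaseSpace N), (∀ (N : ℕ) (T_L T_R : ℝ), 0 < T_L → 0 < T_R → (Literature.MathematicalPhysics.KineticTheory.HeatConduction.pinnedChain ω₂ lam β γ).IsSteadyState N T_L T_R (μ N T_L T_R)) → ∀ T : ℝ, 0 < T → ∀ N : ℕ, ∃ D : ℝ, Filter.Tendsto (fun δ : ℝ => (Literature.MathematicalPhysics.KineticTheory.HeatConduction.pinnedChain ω₂ lam β γ).totalCurrent (μ N (T + δ / 2) (T -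 δ / 2)) / δ) (nhdsWithin 0 {(0 : ℝ)}ᶜ) (nhds D)

/-- item stmt-AtomisticToContinuum-0741 · support · rank 9 · closed · proved by Summit.AtomisticToContinuum.FouriersLaw.Theorems.nessUnique_proof (prover) · by planner
sources: CuneoEckmannHairerReyBellet2018, Carmona2007
[crux] UNIQUENESS OF THE WEAK STEADY STATE (the half of stmt-0706 not covered by the landed fact
Literature.MathematicalPhysics.KineticTheory.HeatConduction.CuneoEckmannHairerReyBellet2018_pinnedChain,
p3544): for pinnedChain ω₂ lam β γ (all > 0), every N and T_L, T_R > 0, any two measures in the weak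
Fokker–Planck class IsSteadyState (probability, ∫ L f dμ = 0 for f ∈ C_c^∞, bond currents
integrable) coincide. Print: uniqueness of the INVARIANT MEASURE of the Langevin semigroup
(CuneoEckmannHairerReyBellet2018 Thm 2.13(1): C1, C2, CA; Carmona2007 Thm 1.1(iii)); the item
additionally needs 'weak stationary probability solution of L*μ = 0 ⇒ P_t-invariant' for this
hypoelliptic L with cubic drift (Echeverría 1982 well-posed martingale problem on C_c^∞ +
non-explosion via e^{θH}; Bogachev–Krylov–Röckner–Shaposhnikov 2015 Ch. 5 is non-degenerate only) —
the FP-identification lemma is the formal crux. N = 0: PhaseSpace 0 is a point (unique probability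
measure); N = 1: both baths on site 0, OU at temperature (T_L+T_R)/2. This is exactly the hypothesis
of FiniteResponse and ThermodynamicLimit and, with the fact, gives clause (i) of FouriersLawFor. -/
@[route_item "route-AtomisticToContinuum-WeylLawForHeat"]
def NessUnique : Prop :=
  ∀ ω₂ lam β γ : ℝ, 0 < ω₂ → 0 < lam → 0 < β → 0 < γ → ∀ (N : ℕ) (T_L T_R : ℝ), 0 < T_L → 0 < T_R → ∀ μ ν : MeasureTheory.Measure (Literature.MathematicalPhysics.KineticTheory.HeatConduction.PhaseSpace N), (Literature.MathematicalPhysics.KineticTheory.HeatConduction.pinnedChain ω₂ lam β γ).IsSteadyState N T_L T_R μ → (Literature.MathematicalPhysics.KineticTheory.HeatConduction.pinnedChain ω₂ lam β γ).IsSteadyState N T_L T_R ν → μ = ν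

/-- `NessUnique` holds: proved by `Summit.AtomisticToContinuum.FouriersLaw.Theorems.nessUnique_proof`. -/
theorem NessUnique_holds : NessUnique := _root_.Summit.AtomisticToContinuum.FouriersLaw.Theorems.nessUnique_proof

/-- item stmt-AtomisticToContinuum-4137 · support · rank 9 · closed · moot by None · by planner
sources: CuneoEckmannHairerReyBellet2018, BonettoLebowitzReyBellet2000
[support] for all parameters > 0, T > 0 and N ≥ 1 the sine energy mode E_N is in L²(μ_N) and has
positive Gibbs variance V_N > 0 (polynomial moments under the Gibbs measure via the proved
e^(ϑH)-integrability; non-constancy of E_N). De-junks the Bochner integrals in U, W, H and feeds the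
L-instance in the assembly. [difficulty: provable-now] -/
@[route_item "route-AtomisticToContinuum-WeylLawForHeat"]
def SineModeBasics : Prop :=
  ∀ ω₂ lam β γ : ℝ, 0 < ω₂ → 0 < lam → 0 < β → 0 < γ → ∀ T : ℝ, 0 < T → (let P := Literature.MathematicalPhysics.KineticTheory.HeatConduction.pinnedChain ω₂ lam β γ; let e : (N : ℕ) → Literature.MathematicalPhysics.KineticTheory.HeatConduction.PhaseSpace N → ℝ := fun N x => (∑ i : Fin N, Real.sin (Real.pi * ((i : ℝ) + 1 / 2) / N) * (x.2 i ^ 2 / 2 + P.U (x.1 i))) + ∑ i : Fin N, ∑ j : Fin N, (if j.val = i.val + 1 then (Real.sin (Real.pi * ((i : ℝ) + 1 / 2) / N) + Real.sin (Real.pi * ((j : ℝ) + 1 / 2) / N)) / 2 * P.V (x.1 j - x.1 i) else 0); let V : ℕ → ℝ := fun N => ∫ x, (e N x - ∫ y, e N y ∂(P.gibbsMeasure N T)) ^ 2 ∂(P.gibbsMeasure N T); ∀ N : ℕ, 1 ≤ N → MeasureTheory.MemLp (e N) 2 (P.gibbsMeasure N T) ∧ 0 < V N)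

/-- item stmt-AtomisticToContinuum-4138 · support · rank 9 · closed · moot by None · by planner
sources: Spohn1991, arXiv:2604.14056, BonettoLebowitzReyBellet2000
[support] for all parameters > 0 and T > 0 the specific heat per site exists: Var_μN(H_N)/(N T²) →
c_v(T) with c_v > 0 (kinetic part alone gives ≥ 1/2; convergence by the 1-D transfer operator
e^(−U/2T)e^(−V(q′−q)/T)e^(−U/2T), Hilbert–Schmidt with simple top eigenvalue, analytic free energy).
Standard 1-D equilibrium statistical mechanics; known, not in tree. [difficulty: L] -/
@[route_item "route-AtomisticToContinuum-WeylLawForHeat"]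
def SpecificHeatLimit : Prop :=
  ∀ ω₂ lam β γ : ℝ, 0 < ω₂ → 0 < lam → 0 < β → 0 < γ → ∀ T : ℝ, 0 < T → (let P := Literature.MathematicalPhysics.KineticTheory.HeatConduction.pinnedChain ω₂ lam β γ; ∃ cv : ℝ, 0 < cv ∧ Filter.Tendsto (fun N : ℕ => (∫ x, (P.hamiltonian N x - ∫ y, P.hamiltonian N y ∂(P.gibbsMeasure N T)) ^ 2 ∂(P.gibbsMeasure N T)) / ((N : ℝ) * T ^ 2)) Filter.atTop (nhds cv))

/-- item stmt-AtomisticToContinuum-4139 · support · rank 9 · closed · moot by None · by planner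
sources: EthierKurtz1986, CuneoEckmannHairerReyBellet2018
[support] for all parameters > 0, T > 0, N ≥ 1 and t ≥ 0 the Gibbs measure is INVARIANT for the
constructed transition kernels at equal bath temperatures: (gibbsMeasure N T).bind (transitionKernel
N T T t) = gibbsMeasure N T. In tree only weak stationarity (pinnedChain_isSteadyState_gibbsMeasure)
is proved; invariance = Echeverría's theorem (weak stationary for a core ⇒ invariant,
EthierKurtz1986 Thm 4.9.17) or Itô on the pathwise solution. Same content as clause (a) of
BoundaryKernelBasics (route EscapeDeficit, stmt-2949); infrastructure for contraction of K_t on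
L²(μ_N) and stationarity of correlations used by every crux. [difficulty: M] -/
@[route_item "route-AtomisticToContinuum-WeylLawForHeat"]
def GibbsKernelInvariant : Prop :=
  ∀ ω₂ lam β γ : ℝ, 0 < ω₂ → 0 < lam → 0 < β → 0 < γ → ∀ T : ℝ, 0 < T → ∀ N : ℕ, 1 ≤ N → ∀ t : NNReal, ((Literature.MathematicalPhysics.KineticTheory.HeatConduction.pinnedChain ω₂ lam β γ).gibbsMeasure N T).bind ((Literature.MathematicalPhysics.KineticTheory.HeatConduction.pinnedChain ω₂ lam β γ).transitionKernel N T T t) = (Literature.MathematicalPhysics.KineticTheory.HeatConduction.pinnedChain ω₂ lam β γ).gibbsMeasure N T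

/-- item stmt-AtomisticToContinuum-4140 · support · rank 9 · closed · moot by None · by planner
sources: HerauHitrikSjostrand2011, KunduDharNarayan2009, BonettoLebowitzReyBellet2000
[support] (card support 4, the structural lever, theorem-grade) DETAILED BALANCE WITH MOMENTUM FLIP
for every chain with C¹ potentials, T > 0 and integrable Gibbs density: for f, g ∈ C²_c, ∫ f·(L g)
dμ_T = ∫ g·((L(f∘Θ))∘Θ) dμ_T with L = P.generator N T T and Θ = momentumReversal — i.e. L† = ΘLΘ in
L²(μ_T) (Liouville part antisymmetric and Θ-odd, Ornstein–Uhlenbeck bath parts symmetric and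
Θ-even), so L is formally self-adjoint for the indefinite (Krein) form [f,g] := ⟨Θf,g⟩
(HerauHitrikSjostrand2011 §3.1 (kfp.5), Props 3.1–3.2). Provable now from the integration-by-parts
lemmas of LangevinChainGibbs (integral_liouville/bath_mul_gibbsDensity). Consequences used
informally by W/H: hydrodynamic eigenvalues are real of positive type, min–max on definite
subspaces. [difficulty: provable-now] -/
@[route_item "route-AtomisticToContinuum-WeylLawForHeat"]
def KreinSymmetry : Prop :=
  ∀ (P : Literature.MathematicalPhysics.KineticTheory.HeatConduction.OscillatorChain), ContDiff ℝ 1 P.U → ContDiff ℝ 1 P.V → ∀ (N : ℕ) (T : ℝ), 0 < T → MeasureTheory.Integrable (P.gibbsDensity N T) → ∀ f g : Literature.MathematicalPhysics.KineticTheory.HeatConduction.PhaseSpace N → ℝ, ContDiff ℝ 2 f → HasCompactSupport f → ContDiff ℝ 2 g → HasCompactSupport g → ∫ x, f x * P.generator N T T g x ∂(P.gibbsMeasure N T) = ∫ x, g x * P.generator N T T (fun y => f (Literature.MathematicalPhysics.KineticTheory.HeatConduction.momentumReversal N y)) (Literature.MathematicalPhysics.KineticTheory.HeatConduction.momentumReversal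 N x) ∂(P.gibbsMeasure N T)

/-- item stmt-AtomisticToContinuum-4141 · assembly · rank 1 · closed · moot by None · by planner
sources: BonettoLebowitzReyBellet2000, CuneoEckmannHairerReyBellet2018, KunduDharNarayan2009
[assembly] fact CuneoEckmannHairerReyBellet2018_pinnedChain → NessUnique → FiniteResponseOfUnique →
SpecificHeatLimit → SineModeBasics → HydrodynamicGap → SineModeDiffusive → WeylScalingDichotomy →
WeylConstantIsConductivity → FouriersLaw. -/
@[route_item "route-AtomisticToContinuum-WeylLawForHeat"]
def Assembly : Prop :=
  Literature.MathematicalPhysics.KineticTheory.HeatConduction.CuneoEckmannHairerReyBellet2018_pinnedChain → NessUnique → FiniteResponseOfUnique → SpecificHeatLimit → SineModeBasics → HydrodynamicGap → SineModeDiffusive → WeylScalingDichotomy → WeylConstantIsConductivity → Literature.MathematicalPhysics.KineticTheory.HeatConduction.FouriersLaw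

end Summit.AtomisticToContinuum.FouriersLaw.Theses.WeylLawForHeat
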